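import Summits.Ventures.Crystal3D.Theorems.StickyWulffConstantTextureLiminfTexShadowWeakZigSplit
import Summits.Ventures.Crystal3D.Theorems.StickyWulffConstantTextureLiminfTexShadowPresentationFlip
import Summits.Ventures.Crystal3D.Theorems.StickyWulffConstantGenericWallFloorBarlowChainReach
import Summits.Ventures.Crystal3D.Theorems.StickyWulffConstantGenericWallFloorCapStartBarlow
import HarnessLib

/-!
# TexShadow §2c — the SHARED and TWIN coincidence classes are sub-classes of the COAXIAL one: `FramesApart` and
# `ZigFramesApart` are their third clause alone, so ONE registered-class stub (`famCoaxial`) implies the other two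
# (lane T, crux `TextureLiminf`, stmt-Ventures-19483, line `TexShadow` v6.17; supplied by lane G, stmt-Ventures-19480, 19480-p2 g9)

HONEST FRAMING. Venture `Summits/Ventures/Crystal3D` (cell `crystal3d-full`), helper `--supports`; rung credit only; F-C1 not moved.
Pure structure (no wall statement is proved): the class inclusions and the stub-level implications.

THE POINT.  Each family frame set contains its BASE frame and the base frame's BASAL TWIN (`self_mem_chainFrames`,
`twinFrame_axis_mem_chainFrames`; for a row plate the twin is inserted by definition), and those two frames carry exactly the plate's
two bilayer lattices `L·Λ₀`, `L·Λ₀⁻ = (twinFrame L (L e₃))·Λ₀` whichever way the plate is presented (`upFrame L z ∈ {L, M∘L}`).  A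
family frame `F` of plate 1 with `F·Λ₀ = L₂·Λ₀` or `= L₂′·Λ₀` is therefore Barlow-COAXIAL (common frame `L₂`) with a family frame of
plate 2.  Hence:
* `coAxFrames_of_common_frame` (linear form of `coaxial_of_common_frame`), `image_twinFrame_axis` (`(twinFrame L (L e₃))·Λ₀ = L·Λ₀⁻`);
* `base_mem_cornerFrames`, `twin_mem_cornerFrames`, `base_mem_zigFrames`, `twin_mem_zigFrames` — as LATTICES: some frame of the family
  carries `L·Λ₀`, some frame carries `L·Λ₀⁻`;
* **`framesApart_iff_sep`**, **`zigFramesApart_iff_sep`** — `FramesApart` / `ZigFramesApart` ⟺ their clause (iii) («no frame of family 1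
  Barlow-coaxial with a frame of family 2») alone;
* class inclusions `coaxialClass_of_sharedClass`, `coaxialClass_of_twinClass` (corner- and zig-keyed), and the stub-level implications
  **`onReachShared_of_onReachCoaxial`**, **`onReachTwin_of_onReachCoaxial`**, **`zigShared_of_zigCoaxial`**, **`zigTwin_of_zigCoaxial`**
  (+ `From` forms) and **`famShared_of_famCoaxial`**, **`famTwin_of_famCoaxial`**:
  `(∃ R, BilayerWallOnReachCoaxialFrom R ∧ BilayerWallZigCoaxialFrom R) → (∃ R, …SharedFrom R ∧ …ZigSharedFrom R)` (idem Twin) — v6.17's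
  `stub_famShared` and `stub_famTwin` are COROLLARIES of `stub_famCoaxial` (9 → 7 stubs if the planner so cuts).
WHAT THIS IS NOT: `stub_famCoaxial` is not proved; F-C1 not moved.
-/

noncomputable section

open scoped BigOperators InnerProductSpace ENNReal
open MeasureTheory Filter

namespace Summit.Ventures.Crystal3D.Cruxes.TextureLiminf.TexShadow

open Summit.Ventures.Crystal3D Summit.Ventures.Crystal3D.Theorems
open Literature.MathematicalPhysics.StatisticalMechanics (IsHaggSeq fccStacking barlowStacking basalMirror constHagg)

/-! ## Linear co-axiality from a common frame -/

/-- The linear image with a zero translation. -/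
theorem image_add_zero (F : E3 ≃ₗᵢ[ℝ] E3) (S : Set E3) : (fun p => F p + (0 : E3)) '' S = F '' S :=
  Set.image_congr fun p _ => add_zero (F p)

/-- **`CoAxFrames` from a common linear frame**: `Fᵢ·Λ₀ ∈ {L·Λ₀, L·Λ₀⁻}` for both `i` ⇒ `CoAxFrames F₁ F₂`. -/
theorem coAxFrames_of_common_frame (F₁ F₂ L : E3 ≃ₗᵢ[ℝ] E3)
    (h₁ : F₁ '' fccStacking 1 (Real.sqrt (2 / 3)) = L '' fccStacking 1 (Real.sqrt (2 / 3)) ∨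
      F₁ '' fccStacking 1 (Real.sqrt (2 / 3)) = L '' barlowStacking 1 (Real.sqrt (2 / 3)) (fun _ : ℤ => (-1 : ℤ)))
    (h₂ : F₂ '' fccStacking 1 (Real.sqrt (2 / 3)) = L '' fccStacking 1 (Real.sqrt (2 / 3)) ∨
      F₂ '' fccStacking 1 (Real.sqrt (2 / 3)) = L '' barlowStacking 1 (Real.sqrt (2 / 3)) (fun _ : ℤ => (-1 : ℤ))) :
    CoAxFrames F₁ F₂ := by
  obtain ⟨L', s₁, s₂, σ, σ', hσ, hσ', e₁, e₂⟩ := coaxial_of_common_frame F₁ F₂ L 0 0 h₁ h₂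
  rw [image_add_zero] at e₁ e₂
  exact ⟨L', s₁, s₂, σ, σ', hσ, hσ', e₁, e₂⟩

/-- `CoAxFrames` is symmetric. -/
theorem CoAxFrames.symm {F₁ F₂ : E3 ≃ₗᵢ[ℝ] E3} (h : CoAxFrames F₁ F₂) : CoAxFrames F₂ F₁ := by
  obtain ⟨L, s₁, s₂, σ, σ', hσ, hσ', e₁, e₂⟩ := h
  exact ⟨L, s₂, s₁, σ', σ, hσ', hσ, e₂, e₁⟩

/-! ## The basal twin lattice -/

/-- The basal mirror image of `Λ₀` is the twin model lattice `Λ₀⁻ = B(−1)`. -/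
theorem image_basalMirror_fcc :
    (basalMirror : E3 ≃ₗᵢ[ℝ] E3) '' fccStacking 1 (Real.sqrt (2 / 3)) = barlowStacking 1 (Real.sqrt (2 / 3)) (fun _ : ℤ => (-1 : ℤ)) := by
  ext y
  constructor
  · rintro ⟨r, hr, rfl⟩
    have h := (basalMirror_mem_barlowStacking_iff constHagg r).2 hr
    exact h
  · intro hy
    refine ⟨basalMirror y, ?_, Literature.MathematicalPhysics.StatisticalMechanics.basalMirror_basalMirror y⟩
    have h := (basalMirror_mem_barlowStacking_iff (fun _ : ℤ => (-1 : ℤ)) y).2 hy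
    have e : (fun n : ℤ => -((fun _ : ℤ => (-1 : ℤ)) (-n - 1))) = constHagg := by
      funext n; simp [Literature.MathematicalPhysics.StatisticalMechanics.constHagg]
    rw [e] at h
    exact h

/-- **`(twinFrame L (L e₃))·Λ₀ = L·Λ₀⁻`.** -/
theorem image_twinFrame_axis (L : E3 ≃ₗᵢ[ℝ] E3) :
    (twinFrame L (L e₃)) '' fccStacking 1 (Real.sqrt (2 / 3)) = L '' barlowStacking 1 (Real.sqrt (2 / 3)) (fun _ : ℤ => (-1 : ℤ)) := by
  rw [← image_basalMirror_fcc, Set.image_image]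
  refine Set.image_congr fun w _ => ?_
  exact twinFrame_axis_apply L w

/-- `(M∘L)·Λ₀ = L·Λ₀⁻`. -/
theorem image_basalMirror_trans (L : E3 ≃ₗᵢ[ℝ] E3) :
    (basalMirror.trans L) '' fccStacking 1 (Real.sqrt (2 / 3)) = L '' barlowStacking 1 (Real.sqrt (2 / 3)) (fun _ : ℤ => (-1 : ℤ)) := by
  rw [← image_basalMirror_fcc, Set.image_image]; rfl

/-- The basal twin of `M∘L` is `L` (as a map). -/
theorem twinFrame_basalMirror_trans (L : E3 ≃ₗᵢ[ℝ] E3) :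
    twinFrame (basalMirror.trans L) ((basalMirror.trans L) e₃) = L := by
  have he : e₃ = EuclideanSpace.single (2 : Fin 3) (1 : ℝ) := rfl
  ext w : 1
  rw [he, twinFrame_axis_apply, LinearIsometryEquiv.trans_apply,
    Literature.MathematicalPhysics.StatisticalMechanics.basalMirror_basalMirror]

/-- **The two bilayer lattices of a plate are carried by its presentation frame and that frame's basal twin, either way round.** -/
theorem lattices_of_upFrame (L : E3 ≃ₗᵢ[ℝ] E3) (z : E3) :
    (upFrame L z '' fccStacking 1 (Real.sqrt (2 / 3)) = L '' fccStacking 1 (Real.sqrt (2 / 3)) ∧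
      (twinFrame (upFrame L z) (upFrame L z e₃)) '' fccStacking 1 (Real.sqrt (2 / 3)) =
        (twinFrame L (L e₃)) '' fccStacking 1 (Real.sqrt (2 / 3))) ∨
    (upFrame L z '' fccStacking 1 (Real.sqrt (2 / 3)) = (twinFrame L (L e₃)) '' fccStacking 1 (Real.sqrt (2 / 3)) ∧
      (twinFrame (upFrame L z) (upFrame L z e₃)) '' fccStacking 1 (Real.sqrt (2 / 3)) = L '' fccStacking 1 (Real.sqrt (2 / 3))) := by
  unfold upFrame
  split_ifs
  · exact Or.inl ⟨rfl, rfl⟩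
  · exact Or.inr ⟨by rw [image_basalMirror_trans, image_twinFrame_axis], by rw [twinFrame_basalMirror_trans]⟩

/-! ## Base frames and their twins are family frames -/

/-- The up-presentation frame is a zig frame. -/
theorem base_mem_zigFrames (L : E3 ≃ₗᵢ[ℝ] E3) (z : E3) : upFrame L z ∈ zigFrames L z :=
  self_mem_chainFrames z _ _

/-- Its basal twin is a zig frame (the family slot is an upper slot). -/
theorem twin_mem_zigFrames (L : E3 ≃ₗᵢ[ℝ] E3) (z : E3) : twinFrame (upFrame L z) (upFrame L z e₃) ∈ zigFrames L z :=
  twinFrame_axis_mem_chainFrames z _ (famSlot_mem L z).2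

/-- **Some zig frame carries `L·Λ₀`, some zig frame carries `L·Λ₀⁻`.** -/
theorem exists_zigFrames_lattices (L : E3 ≃ₗᵢ[ℝ] E3) (z : E3) :
    (∃ G ∈ zigFrames L z, G '' fccStacking 1 (Real.sqrt (2 / 3)) = L '' fccStacking 1 (Real.sqrt (2 / 3))) ∧
    (∃ G ∈ zigFrames L z, G '' fccStacking 1 (Real.sqrt (2 / 3)) = (twinFrame L (L e₃)) '' fccStacking 1 (Real.sqrt (2 / 3))) := by
  rcases lattices_of_upFrame L z with ⟨h1, h2⟩ | ⟨h1, h2⟩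
  · exact ⟨⟨_, base_mem_zigFrames L z, h1⟩, ⟨_, twin_mem_zigFrames L z, h2⟩⟩
  · exact ⟨⟨_, twin_mem_zigFrames L z, h2⟩, ⟨_, base_mem_zigFrames L z, h1⟩⟩

/-- **Some corner frame carries `L·Λ₀`, some corner frame carries `L·Λ₀⁻`** (zig-good: the zig frames; rows: `L` and its inserted twin). -/
theorem exists_cornerFrames_lattices (L : E3 ≃ₗᵢ[ℝ] E3) (σ : ℤ → ℤ) (z : E3) :
    (∃ G ∈ cornerFrames L σ z, G '' fccStacking 1 (Real.sqrt (2 / 3)) = L '' fccStacking 1 (Real.sqrt (2 / 3))) ∧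
    (∃ G ∈ cornerFrames L σ z, G '' fccStacking 1 (Real.sqrt (2 / 3)) = (twinFrame L (L e₃)) '' fccStacking 1 (Real.sqrt (2 / 3))) := by
  classical
  by_cases hZ : ZigGood L σ z
  · rw [cornerFrames_eq_zigFrames hZ]; exact exists_zigFrames_lattices L z
  · rw [(corner_of_not_zigGood hZ 0).2.2.1]
    exact ⟨⟨L, Set.mem_insert_of_mem _ (self_mem_chainFrames z L _), rfl⟩, ⟨_, Set.mem_insert _ _, rfl⟩⟩

/-- A frame carrying `L·Λ₀` or `L·Λ₀⁻` is coaxial with every frame carrying `L·Λ₀` or `L·Λ₀⁻`. -/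
theorem coAxFrames_of_lattices {F G L : E3 ≃ₗᵢ[ℝ] E3}
    (hF : F '' fccStacking 1 (Real.sqrt (2 / 3)) = L '' fccStacking 1 (Real.sqrt (2 / 3)) ∨
      F '' fccStacking 1 (Real.sqrt (2 / 3)) = (twinFrame L (L e₃)) '' fccStacking 1 (Real.sqrt (2 / 3)))
    (hG : G '' fccStacking 1 (Real.sqrt (2 / 3)) = L '' fccStacking 1 (Real.sqrt (2 / 3)) ∨
      G '' fccStacking 1 (Real.sqrt (2 / 3)) = (twinFrame L (L e₃)) '' fccStacking 1 (Real.sqrt (2 / 3))) :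
    CoAxFrames F G := by
  rw [image_twinFrame_axis] at hF hG
  exact coAxFrames_of_common_frame F G L hF hG

/-! ## The keys are their third clause -/

/-- **`ZigFramesApart` ⟺ its separation clause (iii).** -/
theorem zigFramesApart_iff_sep (L₁ L₂ : E3 ≃ₗᵢ[ℝ] E3) (s₁ s₂ : E3) (σ₁ σ₂ : ℤ → ℤ) :
    ZigFramesApart L₁ s₁ σ₁ L₂ s₂ σ₂ ↔ ∀ F₁ ∈ zigFrames L₁ e₃, ∀ F₂ ∈ zigFrames L₂ (-e₃), ¬ CoAxFrames F₁ F₂ := by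
  refine ⟨fun h => h.2.2, fun h => ⟨fun F hF => ?_, fun F hF => ?_, h⟩⟩
  · obtain ⟨⟨G, hG, eG⟩, ⟨G', hG', eG'⟩⟩ := exists_zigFrames_lattices L₂ (-e₃)
    exact ⟨fun e => h F hF G hG (coAxFrames_of_lattices (Or.inl e) (Or.inl eG)),
      fun e => h F hF G' hG' (coAxFrames_of_lattices (Or.inr e) (Or.inr eG'))⟩
  · obtain ⟨⟨G, hG, eG⟩, ⟨G', hG', eG'⟩⟩ := exists_zigFrames_lattices L₁ e₃
    exact ⟨fun e => h G hG F hF (coAxFrames_of_lattices (Or.inl eG) (Or.inl e)),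
      fun e => h G' hG' F hF (coAxFrames_of_lattices (Or.inr eG') (Or.inr e))⟩

/-- **`FramesApart` ⟺ its separation clause (iii).** -/
theorem framesApart_iff_sep (L₁ L₂ : E3 ≃ₗᵢ[ℝ] E3) (s₁ s₂ : E3) (σ₁ σ₂ : ℤ → ℤ) :
    FramesApart L₁ s₁ σ₁ L₂ s₂ σ₂ ↔ ∀ F₁ ∈ cornerFrames L₁ σ₁ e₃, ∀ F₂ ∈ cornerFrames L₂ σ₂ (-e₃), ¬ CoAxFrames F₁ F₂ := by
  refine ⟨fun h => h.2.2, fun h => ⟨fun F hF => ?_, fun F hF => ?_, h⟩⟩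
  · obtain ⟨⟨G, hG, eG⟩, ⟨G', hG', eG'⟩⟩ := exists_cornerFrames_lattices L₂ σ₂ (-e₃)
    exact ⟨fun e => h F hF G hG (coAxFrames_of_lattices (Or.inl e) (Or.inl eG)),
      fun e => h F hF G' hG' (coAxFrames_of_lattices (Or.inr e) (Or.inr eG'))⟩
  · obtain ⟨⟨G, hG, eG⟩, ⟨G', hG', eG'⟩⟩ := exists_cornerFrames_lattices L₁ σ₁ e₃
    exact ⟨fun e => h G hG F hF (coAxFrames_of_lattices (Or.inl eG) (Or.inl e)),
      fun e => h G' hG' F hF (coAxFrames_of_lattices (Or.inr eG') (Or.inr e))⟩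

/-! ## Class inclusions -/

/-- A SHARED-lattice coincidence (corner-keyed) is a coaxial coincidence. -/
theorem coaxialClass_of_sharedClass {L₁ L₂ : E3 ≃ₗᵢ[ℝ] E3} {σ₁ σ₂ : ℤ → ℤ}
    (h : (∃ F ∈ cornerFrames L₁ σ₁ e₃, F '' fccStacking 1 (Real.sqrt (2 / 3)) = L₂ '' fccStacking 1 (Real.sqrt (2 / 3))) ∨
      (∃ F ∈ cornerFrames L₂ σ₂ (-e₃), F '' fccStacking 1 (Real.sqrt (2 / 3)) = L₁ '' fccStacking 1 (Real.sqrt (2 / 3)))) :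
    ∃ F₁ ∈ cornerFrames L₁ σ₁ e₃, ∃ F₂ ∈ cornerFrames L₂ σ₂ (-e₃), CoAxFrames F₁ F₂ := by
  rcases h with ⟨F, hF, e⟩ | ⟨F, hF, e⟩
  · obtain ⟨⟨G, hG, eG⟩, -⟩ := exists_cornerFrames_lattices L₂ σ₂ (-e₃)
    exact ⟨F, hF, G, hG, coAxFrames_of_lattices (Or.inl e) (Or.inl eG)⟩
  · obtain ⟨⟨G, hG, eG⟩, -⟩ := exists_cornerFrames_lattices L₁ σ₁ e₃
    exact ⟨G, hG, F, hF, coAxFrames_of_lattices (Or.inl eG) (Or.inl e)⟩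

/-- A TWIN-lattice coincidence (corner-keyed) is a coaxial coincidence. -/
theorem coaxialClass_of_twinClass {L₁ L₂ : E3 ≃ₗᵢ[ℝ] E3} {σ₁ σ₂ : ℤ → ℤ}
    (h : (∃ F ∈ cornerFrames L₁ σ₁ e₃, F '' fccStacking 1 (Real.sqrt (2 / 3)) = (twinFrame L₂ (L₂ e₃)) '' fccStacking 1 (Real.sqrt (2 / 3))) ∨
      (∃ F ∈ cornerFrames L₂ σ₂ (-e₃), F '' fccStacking 1 (Real.sqrt (2 / 3)) = (twinFrame L₁ (L₁ e₃)) '' fccStacking 1 (Real.sqrt (2 / 3)))) :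
    ∃ F₁ ∈ cornerFrames L₁ σ₁ e₃, ∃ F₂ ∈ cornerFrames L₂ σ₂ (-e₃), CoAxFrames F₁ F₂ := by
  rcases h with ⟨F, hF, e⟩ | ⟨F, hF, e⟩
  · obtain ⟨-, ⟨G, hG, eG⟩⟩ := exists_cornerFrames_lattices L₂ σ₂ (-e₃)
    exact ⟨F, hF, G, hG, coAxFrames_of_lattices (Or.inr e) (Or.inr eG)⟩
  · obtain ⟨-, ⟨G, hG, eG⟩⟩ := exists_cornerFrames_lattices L₁ σ₁ e₃
    exact ⟨G, hG, F, hF, coAxFrames_of_lattices (Or.inr eG) (Or.inr e)⟩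

/-- A SHARED-lattice coincidence (zig-keyed) is a coaxial coincidence. -/
theorem zigCoaxialClass_of_zigSharedClass {L₁ L₂ : E3 ≃ₗᵢ[ℝ] E3}
    (h : (∃ F ∈ zigFrames L₁ e₃, F '' fccStacking 1 (Real.sqrt (2 / 3)) = L₂ '' fccStacking 1 (Real.sqrt (2 / 3))) ∨
      (∃ F ∈ zigFrames L₂ (-e₃), F '' fccStacking 1 (Real.sqrt (2 / 3)) = L₁ '' fccStacking 1 (Real.sqrt (2 / 3)))) :
    ∃ F₁ ∈ zigFrames L₁ e₃, ∃ F₂ ∈ zigFrames L₂ (-e₃), CoAxFrames F₁ F₂ := by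
  rcases h with ⟨F, hF, e⟩ | ⟨F, hF, e⟩
  · obtain ⟨⟨G, hG, eG⟩, -⟩ := exists_zigFrames_lattices L₂ (-e₃)
    exact ⟨F, hF, G, hG, coAxFrames_of_lattices (Or.inl e) (Or.inl eG)⟩
  · obtain ⟨⟨G, hG, eG⟩, -⟩ := exists_zigFrames_lattices L₁ e₃
    exact ⟨G, hG, F, hF, coAxFrames_of_lattices (Or.inl eG) (Or.inl e)⟩

/-- A TWIN-lattice coincidence (zig-keyed) is a coaxial coincidence. -/
theorem zigCoaxialClass_of_zigTwinClass {L₁ L₂ : E3 ≃ₗᵢ[ℝ] E3}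
    (h : (∃ F ∈ zigFrames L₁ e₃, F '' fccStacking 1 (Real.sqrt (2 / 3)) = (twinFrame L₂ (L₂ e₃)) '' fccStacking 1 (Real.sqrt (2 / 3))) ∨
      (∃ F ∈ zigFrames L₂ (-e₃), F '' fccStacking 1 (Real.sqrt (2 / 3)) = (twinFrame L₁ (L₁ e₃)) '' fccStacking 1 (Real.sqrt (2 / 3)))) :
    ∃ F₁ ∈ zigFrames L₁ e₃, ∃ F₂ ∈ zigFrames L₂ (-e₃), CoAxFrames F₁ F₂ := by
  rcases h with ⟨F, hF, e⟩ | ⟨F, hF, e⟩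
  · obtain ⟨-, ⟨G, hG, eG⟩⟩ := exists_zigFrames_lattices L₂ (-e₃)
    exact ⟨F, hF, G, hG, coAxFrames_of_lattices (Or.inr e) (Or.inr eG)⟩
  · obtain ⟨-, ⟨G, hG, eG⟩⟩ := exists_zigFrames_lattices L₁ e₃
    exact ⟨G, hG, F, hF, coAxFrames_of_lattices (Or.inr eG) (Or.inr e)⟩

/-! ## Stub-level implications: `famCoaxial ⇒ famShared, famTwin` -/

/-- O3 ⇒ O1 at fixed constants. -/
theorem onReachShared_of_onReachCoaxial {C R₀ : ℝ} (h : BilayerWallOnReachCoaxial C R₀) : BilayerWallOnReachShared C R₀ :=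
  fun σ₁ σ₂ hσ₁ hσ₂ L₁ L₂ s₁ s₂ A₁ A₂ u₁ u₂ hu₁ hu₂ hgen c m hadm hdom hcl =>
    h σ₁ σ₂ hσ₁ hσ₂ L₁ L₂ s₁ s₂ A₁ A₂ u₁ u₂ hu₁ hu₂ hgen c m hadm hdom (coaxialClass_of_sharedClass hcl)

/-- O3 ⇒ O2 at fixed constants. -/
theorem onReachTwin_of_onReachCoaxial {C R₀ : ℝ} (h : BilayerWallOnReachCoaxial C R₀) : BilayerWallOnReachTwin C R₀ :=
  fun σ₁ σ₂ hσ₁ hσ₂ L₁ L₂ s₁ s₂ A₁ A₂ u₁ u₂ hu₁ hu₂ hgen c m hadm hdom hcl =>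
    h σ₁ σ₂ hσ₁ hσ₂ L₁ L₂ s₁ s₂ A₁ A₂ u₁ u₂ hu₁ hu₂ hgen c m hadm hdom (coaxialClass_of_twinClass hcl)

/-- ZO3 ⇒ ZO1 at fixed constants. -/
theorem zigShared_of_zigCoaxial {C R₀ : ℝ} (h : BilayerWallZigCoaxial C R₀) : BilayerWallZigShared C R₀ :=
  fun σ₁ σ₂ hσ₁ hσ₂ L₁ L₂ s₁ s₂ A₁ A₂ u₁ u₂ hu₁ hu₂ hgen c m hadm hΔ₁ hΔ₂ hFD hBOR hRow hZG hcl =>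
    h σ₁ σ₂ hσ₁ hσ₂ L₁ L₂ s₁ s₂ A₁ A₂ u₁ u₂ hu₁ hu₂ hgen c m hadm hΔ₁ hΔ₂ hFD hBOR hRow hZG (zigCoaxialClass_of_zigSharedClass hcl)

/-- ZO3 ⇒ ZO2 at fixed constants. -/
theorem zigTwin_of_zigCoaxial {C R₀ : ℝ} (h : BilayerWallZigCoaxial C R₀) : BilayerWallZigTwin C R₀ :=
  fun σ₁ σ₂ hσ₁ hσ₂ L₁ L₂ s₁ s₂ A₁ A₂ u₁ u₂ hu₁ hu₂ hgen c m hadm hΔ₁ hΔ₂ hFD hBOR hRow hZG hcl =>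
    h σ₁ σ₂ hσ₁ hσ₂ L₁ L₂ s₁ s₂ A₁ A₂ u₁ u₂ hu₁ hu₂ hgen c m hadm hΔ₁ hΔ₂ hFD hBOR hRow hZG (zigCoaxialClass_of_zigTwinClass hcl)

/-- `From` form: O3 ⇒ O1. -/
theorem onReachSharedFrom_of_onReachCoaxialFrom {R : ℝ} (h : BilayerWallOnReachCoaxialFrom R) : BilayerWallOnReachSharedFrom R :=
  fun R₀ hR₀ => by obtain ⟨C, hC⟩ := h R₀ hR₀; exact ⟨C, onReachShared_of_onReachCoaxial hC⟩

/-- `From` form: O3 ⇒ O2. -/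
theorem onReachTwinFrom_of_onReachCoaxialFrom {R : ℝ} (h : BilayerWallOnReachCoaxialFrom R) : BilayerWallOnReachTwinFrom R :=
  fun R₀ hR₀ => by obtain ⟨C, hC⟩ := h R₀ hR₀; exact ⟨C, onReachTwin_of_onReachCoaxial hC⟩

/-- `From` form: ZO3 ⇒ ZO1. -/
theorem zigSharedFrom_of_zigCoaxialFrom {R : ℝ} (h : BilayerWallZigCoaxialFrom R) : BilayerWallZigSharedFrom R :=
  fun R₀ hR₀ => by obtain ⟨C, hC⟩ := h R₀ hR₀; exact ⟨C, zigShared_of_zigCoaxial hC⟩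

/-- `From` form: ZO3 ⇒ ZO2. -/
theorem zigTwinFrom_of_zigCoaxialFrom {R : ℝ} (h : BilayerWallZigCoaxialFrom R) : BilayerWallZigTwinFrom R :=
  fun R₀ hR₀ => by obtain ⟨C, hC⟩ := h R₀ hR₀; exact ⟨C, zigTwin_of_zigCoaxial hC⟩

/-- **`stub_famCoaxial ⇒ stub_famShared`** (v6.17's stub shapes). -/
theorem famShared_of_famCoaxial (h : ∃ R : ℝ, BilayerWallOnReachCoaxialFrom R ∧ BilayerWallZigCoaxialFrom R) :
    ∃ R : ℝ, BilayerWallOnReachSharedFrom R ∧ BilayerWallZigSharedFrom R := by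
  obtain ⟨R, h1, h2⟩ := h
  exact ⟨R, onReachSharedFrom_of_onReachCoaxialFrom h1, zigSharedFrom_of_zigCoaxialFrom h2⟩

/-- **`stub_famCoaxial ⇒ stub_famTwin`** (v6.17's stub shapes). -/
theorem famTwin_of_famCoaxial (h : ∃ R : ℝ, BilayerWallOnReachCoaxialFrom R ∧ BilayerWallZigCoaxialFrom R) :
    ∃ R : ℝ, BilayerWallOnReachTwinFrom R ∧ BilayerWallZigTwinFrom R := by
  obtain ⟨R, h1, h2⟩ := h
  exact ⟨R, onReachTwinFrom_of_onReachCoaxialFrom h1, zigTwinFrom_of_zigCoaxialFrom h2⟩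

/-- **One-call closing of `stub_bilayerWallOnReachAll` from `famCoaxial` alone** (mod E1 / StarPairFar). -/
theorem bilayerWallOnReachAllFrom_of_famCoaxial
    {sE : E3} (hsE : sE ∈ fccSlots) (hcert : ExactOnly 0 (fccSlots.filter fun w => 0 < ⟪w, sE⟫_ℝ))
    (hDS : ∀ F₁ F₂ : E3 ≃ₗᵢ[ℝ] E3, DoubleStarCoaxialAt F₁ F₂) (hCP : CapPairCoaxial)
    (h : ∃ R : ℝ, BilayerWallOnReachCoaxialFrom R ∧ BilayerWallZigCoaxialFrom R) :
    ∃ R : ℝ, BilayerWallOnReachAllFrom FramesApart R := by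
  obtain ⟨R, hC, hZC⟩ := h
  exact bilayerWallOnReachAllFrom_of_classes hsE hcert hDS hCP (onReachSharedFrom_of_onReachCoaxialFrom hC)
    (onReachTwinFrom_of_onReachCoaxialFrom hC) hC (zigSharedFrom_of_zigCoaxialFrom hZC) (zigTwinFrom_of_zigCoaxialFrom hZC) hZC

end Summit.Ventures.Crystal3D.Cruxes.TextureLiminf.TexShadow

end
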